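import Summits.AtomisticToContinuum.HydrodynamicLimit.Theorems.StiffCollisionalRelaxationAprioriBoundsFibreDefs
import Summits.AtomisticToContinuum.HydrodynamicLimit.Theorems.OneFlightGossipEngineEnergyCurrentTailsLevelCensusStatics
import Mathlib.Probability.Moments.SubGaussian
import HarnessLib

/-!
# The lever `stub_deficitTransfer` of the line `fibre-deficit-transfer` (crux `AprioriBounds`,
stmt-AtomisticToContinuum-14827), part 3: Hoeffding for the one-particle tail fraction under a local Gibbs law

Support file (`--supports stmt-AtomisticToContinuum-14827`) of the lead prover of the line.  Under a local Gibbs law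
`localGibbsLaw σ b w ϑ N Φ` with continuous positive parameters the velocities are, GIVEN THE POSITIONS, independent
Gaussians `N(w(xᵢ), ϑ(xᵢ)·id)` (`lintegral_localGibbsMeasure`; the tilted reference `G_s` of the line is such a law,
part 1).  Hence the tail fraction `frac_K = (N+1)⁻¹ #{i | K ≤ |vᵢ|²}` is an average of independent Bernoulli variables
whose means are sub-Maxwellian UNIFORMLY in the level `K` (Chernoff with a Fernique exponential moment of the Gaussian,
`EnergyCurrentTailsLevelCensus.lintegral_exp_mul_norm_sq_gaussMeasure_le`), and Hoeffding's inequality (Mathlib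
`ProbabilityTheory.measure_sum_ge_le_of_iIndepFun` with `hasSubgaussianMGF_of_mem_Icc`, independence of the coordinates
of a product measure `iIndepFun_pi`) gives, uniformly in `K`,

  `G{ 2A e^{−K/(2Θ)} + δ < frac_K } ≤ exp(−2(N+1)δ²)`      (`exists_frac_tail_bound`, registered sub-goal),

with `Θ, A` depending only on an upper bound `Θm` of the temperatures and `U` of the drifts.
-/

noncomputable section

open MeasureTheory ProbabilityTheory Filter Set Topology
open scoped ENNReal NNReal

namespace Summit.AtomisticToContinuum.HydrodynamicLimit.Theorems.FibreDeficitTransfer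

open Literature.MathematicalPhysics.KineticTheory Literature.Analysis.FluidPDE
open Summit.AtomisticToContinuum.HydrodynamicLimit.Theorems.VisitLedgerUpscattering (Cfg Flow Flows NiceProfiles)
open EnergyCurrentTailsLevelCensus (lintegral_exp_mul_norm_sq_gaussMeasure_le lintegral_vel_localGibbsLaw_le)

/-! ## One Gaussian: sub-Maxwellian tails uniformly in the level -/

/-- Chernoff's pointwise bound for the closed level set: `𝟙{K ≤ ‖v‖²} ≤ e^{−αK} e^{α‖v‖²}` (`α ≥ 0`). -/
theorem indicator_levelGe_le_exp {α : ℝ} (hα : 0 ≤ α) (K : ℝ) (v : V3) :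
    Set.indicator {v : V3 | K ≤ ‖v‖ ^ 2} (fun _ => (1 : ℝ≥0∞)) v ≤
      ENNReal.ofReal (Real.exp (-(α * K))) * ENNReal.ofReal (Real.exp (α * ‖v‖ ^ 2)) := by
  by_cases hv : K ≤ ‖v‖ ^ 2
  · rw [Set.indicator_of_mem (show v ∈ {v : V3 | K ≤ ‖v‖ ^ 2} from hv),
      ← ENNReal.ofReal_mul (Real.exp_pos _).le, ← Real.exp_add]
    refine ENNReal.one_le_ofReal.2 (Real.one_le_exp ?_)
    nlinarith [mul_le_mul_of_nonneg_left hv hα]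
  · rw [Set.indicator_of_notMem (show v ∉ {v : V3 | K ≤ ‖v‖ ^ 2} from hv)]
    exact bot_le

/-- **Uniform Gaussian tail constants.**  For every temperature bound `Θm > 0` and drift bound `U` there are `Θ > 0`,
`A ≥ 0` with `N(w, ϑ·id){K ≤ ‖v‖²} ≤ A e^{−K/(2Θ)}` for all `0 < ϑ ≤ Θm`, `‖w‖ ≤ U` and ALL `K ∈ ℝ` (Fernique + Chernoff). -/
theorem exists_gauss_tail_bound {Θm : ℝ} (hΘm : 0 < Θm) (U : ℝ) :
    ∃ Θ A : ℝ, 0 < Θ ∧ 0 ≤ A ∧ ∀ (w : V3) (ϑ : ℝ), 0 < ϑ → ϑ ≤ Θm → ‖w‖ ≤ U → ∀ K : ℝ,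
      gaussMeasure w ϑ {v : V3 | K ≤ ‖v‖ ^ 2} ≤ ENNReal.ofReal (A * Real.exp (-(K / (2 * Θ)))) := by
  obtain ⟨C, hC, hint⟩ := IsGaussian.exists_integrable_exp_sq (stdGaussian V3)
  set α₀ : ℝ := C / (2 * Θm) with hα₀
  have hα₀pos : 0 < α₀ := div_pos hC (by positivity)
  set A : ℝ := Real.exp (2 * α₀ * U ^ 2) * ∫ x, Real.exp (C * ‖x‖ ^ 2) ∂stdGaussian V3 with hA
  have hA0 : 0 ≤ A := mul_nonneg (Real.exp_pos _).le (integral_nonneg fun _ => (Real.exp_pos _).le)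
  refine ⟨1 / (2 * α₀), A, by positivity, hA0, fun w ϑ hϑ hϑm hw K => ?_⟩
  have hmom : ∫⁻ v, ENNReal.ofReal (Real.exp (α₀ * ‖v‖ ^ 2)) ∂gaussMeasure w ϑ ≤ ENNReal.ofReal A := by
    refine lintegral_exp_mul_norm_sq_gaussMeasure_le w hint hα₀pos.le hϑ.le ?_ hw
    calc 2 * α₀ * ϑ ≤ 2 * α₀ * Θm := mul_le_mul_of_nonneg_left hϑm (by positivity)
      _ = C := by rw [hα₀]; field_simp
  have hS : MeasurableSet {v : V3 | K ≤ ‖v‖ ^ 2} := measurableSet_le measurable_const (measurable_norm.pow_const 2)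
  have hexpK : Real.exp (-(K / (2 * (1 / (2 * α₀))))) = Real.exp (-(α₀ * K)) := by
    congr 1; field_simp
  calc gaussMeasure w ϑ {v : V3 | K ≤ ‖v‖ ^ 2}
      = ∫⁻ v, Set.indicator {v : V3 | K ≤ ‖v‖ ^ 2} (fun _ => (1 : ℝ≥0∞)) v ∂gaussMeasure w ϑ :=
        (lintegral_indicator_one hS).symm
    _ ≤ ∫⁻ v, ENNReal.ofReal (Real.exp (-(α₀ * K))) * ENNReal.ofReal (Real.exp (α₀ * ‖v‖ ^ 2)) ∂gaussMeasure w ϑ :=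
        lintegral_mono fun v => indicator_levelGe_le_exp hα₀pos.le K v
    _ ≤ ENNReal.ofReal (Real.exp (-(α₀ * K))) * ENNReal.ofReal A := by
        rw [lintegral_const_mul _ ((measurable_norm.pow_const 2).const_mul α₀).exp.ennreal_ofReal]
        exact mul_le_mul_right hmom _
    _ = ENNReal.ofReal (A * Real.exp (-(K / (2 * (1 / (2 * α₀)))))) := by
        rw [hexpK, ← ENNReal.ofReal_mul (Real.exp_pos _).le, mul_comm]

/-! ## Hoeffding for the tail fraction under a product of Gaussians -/

/-- **Hoeffding for the fraction of coordinates above a level**, under a product of probability measures on `ℝ³`: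
if every factor gives the level set mass `≤ q`, then `P{ 2q + δ < (N+1)⁻¹ #{i | K ≤ ‖vᵢ‖²} } ≤ exp(−2(N+1)δ²)`. -/
theorem pi_frac_gt_le {N : ℕ} (μ : Fin (N + 1) → Measure V3) [∀ i, IsProbabilityMeasure (μ i)] {K q δ : ℝ}
    (hq : ∀ i, μ i {v : V3 | K ≤ ‖v‖ ^ 2} ≤ ENNReal.ofReal q) (hq0 : 0 ≤ q) (hδ : 0 ≤ δ) :
    Measure.pi μ {v : Fin (N + 1) → V3 | 2 * q + δ <
        ((N + 1 : ℕ) : ℝ)⁻¹ * ∑ i, (if K ≤ ‖v i‖ ^ 2 then (1 : ℝ) else 0)} ≤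
      ENNReal.ofReal (Real.exp (-(2 * ((N : ℝ) + 1) * δ ^ 2))) := by
  set P : Measure (Fin (N + 1) → V3) := Measure.pi μ with hP
  have hS : MeasurableSet {v : V3 | K ≤ ‖v‖ ^ 2} := measurableSet_le measurable_const (measurable_norm.pow_const 2)
  -- the Bernoulli coordinates and their centred versions
  set Y : Fin (N + 1) → (Fin (N + 1) → V3) → ℝ := fun i v => if K ≤ ‖v i‖ ^ 2 then 1 else 0 with hY
  have hY1 : Measurable fun v : V3 => if K ≤ ‖v‖ ^ 2 then (1 : ℝ) else 0 :=
    Measurable.ite hS measurable_const measurable_const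
  have hYm : ∀ i, Measurable (Y i) := fun i => hY1.comp (measurable_pi_apply i)
  have hYmem : ∀ i v, Y i v ∈ Icc (0 : ℝ) 1 := fun i v => by
    simp only [hY]; split_ifs <;> norm_num
  -- means: `P[Y i] = μ i (level set) ≤ q`
  have hmean : ∀ i, ∫ v, Y i v ∂P ≤ q := by
    intro i
    have hpres : MeasurePreserving (Function.eval i) P (μ i) := by rw [hP]; exact measurePreserving_eval μ i
    have h1 : ∫ v, Y i v ∂P = ∫ x, (if K ≤ ‖x‖ ^ 2 then (1 : ℝ) else 0) ∂(μ i) := by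
      rw [← hpres.map_eq, integral_map (measurable_pi_apply i).aemeasurable hY1.aestronglyMeasurable]
    have h2 : (fun x : V3 => if K ≤ ‖x‖ ^ 2 then (1 : ℝ) else 0) = {v : V3 | K ≤ ‖v‖ ^ 2}.indicator 1 := by
      funext x
      by_cases hx : K ≤ ‖x‖ ^ 2
      · rw [if_pos hx, indicator_of_mem (show x ∈ {v : V3 | K ≤ ‖v‖ ^ 2} from hx), Pi.one_apply]
      · rw [if_neg hx, indicator_of_notMem (show x ∉ {v : V3 | K ≤ ‖v‖ ^ 2} from hx)]
    rw [h1, h2, integral_indicator_one hS]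
    exact ENNReal.toReal_le_of_le_ofReal hq0 (hq i)
  have hmean0 : ∀ i, 0 ≤ ∫ v, Y i v ∂P := fun i => integral_nonneg fun v => (hYmem i v).1
  -- independence and sub-Gaussianity of the centred coordinates
  set X : Fin (N + 1) → (Fin (N + 1) → V3) → ℝ := fun i v => Y i v - ∫ v', Y i v' ∂P with hX
  have hind : iIndepFun X P := by
    have h := iIndepFun_pi (μ := μ) (X := fun i (x : V3) => (if K ≤ ‖x‖ ^ 2 then (1 : ℝ) else 0) - ∫ v', Y i v' ∂P)
      fun i => (hY1.sub measurable_const).aemeasurable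
    exact h
  have hsub : ∀ i ∈ (Finset.univ : Finset (Fin (N + 1))),
      HasSubgaussianMGF (X i) ((‖(1 : ℝ) - 0‖₊ / 2) ^ 2) P := fun i _ =>
    hasSubgaussianMGF_of_mem_Icc (hYm i).aemeasurable (ae_of_all _ (hYmem i))
  -- Hoeffding
  have hε : 0 ≤ ((N : ℝ) + 1) * δ := by positivity
  have hoeff₀ := HasSubgaussianMGF.measure_sum_ge_le_of_iIndepFun hind hsub hε
  have hc : ((∑ i ∈ (Finset.univ : Finset (Fin (N + 1))), ((‖(1 : ℝ) - 0‖₊ / 2) ^ 2 : ℝ≥0) : ℝ≥0) : ℝ) =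
      ((N : ℝ) + 1) / 4 := by
    have h1 : (‖(1 : ℝ) - 0‖₊ : ℝ≥0) = 1 := by rw [sub_zero, nnnorm_one]
    rw [h1, Finset.sum_const, Finset.card_univ, Fintype.card_fin, nsmul_eq_mul]
    push_cast
    ring
  have hoeff : P.real {v | ((N : ℝ) + 1) * δ ≤ ∑ i ∈ Finset.univ, X i v} ≤ Real.exp (-(2 * ((N : ℝ) + 1) * δ ^ 2)) := by
    refine hoeff₀.trans_eq ?_
    rw [hc]
    congr 1
    have hN : (N : ℝ) + 1 ≠ 0 := by positivity
    field_simp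
    ring
  -- event inclusion
  have hincl : {v : Fin (N + 1) → V3 | 2 * q + δ < ((N + 1 : ℕ) : ℝ)⁻¹ * ∑ i, (if K ≤ ‖v i‖ ^ 2 then (1 : ℝ) else 0)} ⊆
      {v | ((N : ℝ) + 1) * δ ≤ ∑ i ∈ Finset.univ, X i v} := by
    intro v hv
    simp only [mem_setOf_eq] at hv ⊢
    have hN : (0 : ℝ) < (N : ℝ) + 1 := by positivity
    have hv' : ((N : ℝ) + 1) * (2 * q + δ) < ∑ i, Y i v := by
      rw [Nat.cast_add_one, inv_mul_eq_div, lt_div_iff₀ hN] at hv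
      simpa only [hY, mul_comm] using hv
    have hsumX : ∑ i, X i v = ∑ i, Y i v - ∑ i, ∫ v', Y i v' ∂P := by
      simp only [hX, Finset.sum_sub_distrib]
    have hsumq : ∑ i : Fin (N + 1), ∫ v', Y i v' ∂P ≤ ((N : ℝ) + 1) * q := by
      calc ∑ i : Fin (N + 1), ∫ v', Y i v' ∂P ≤ ∑ _i : Fin (N + 1), q := Finset.sum_le_sum fun i _ => hmean i
        _ = ((N : ℝ) + 1) * q := by simp
    rw [hsumX]
    nlinarith
  calc P {v : Fin (N + 1) → V3 | 2 * q + δ < ((N + 1 : ℕ) : ℝ)⁻¹ * ∑ i, (if K ≤ ‖v i‖ ^ 2 then (1 : ℝ) else 0)}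
      ≤ P {v | ((N : ℝ) + 1) * δ ≤ ∑ i ∈ Finset.univ, X i v} := measure_mono hincl
    _ = ENNReal.ofReal (P.real {v | ((N : ℝ) + 1) * δ ≤ ∑ i ∈ Finset.univ, X i v}) :=
        (ENNReal.ofReal_toReal (measure_ne_top _ _)).symm
    _ ≤ ENNReal.ofReal (Real.exp (-(2 * ((N : ℝ) + 1) * δ ^ 2))) := ENNReal.ofReal_le_ofReal hoeff

/-! ## Under a local Gibbs law -/

/-- **Hoeffding for the tail fraction under a local Gibbs law** (registered sub-goal of this file).  For every
temperature bound `Θm > 0` and drift bound `U` there are `Θ > 0`, `A ≥ 0` such that for ALL continuous positive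
parameters `(b, w, ϑ)` with `ϑ ≤ Θm`, `‖w‖ ≤ U`, every `σ ≤ 1/2`, `N`, flow, level `K ∈ ℝ` and `δ ≥ 0`:
`localGibbsLaw σ b w ϑ N Φ { 2A e^{−K/(2Θ)} + δ < frac_K } ≤ exp(−2(N+1)δ²)`. -/
theorem exists_frac_tail_bound : ∀ (Θm U : ℝ), 0 < Θm → ∃ Θ A : ℝ, 0 < Θ ∧ 0 ≤ A ∧ ∀ (σ : ℝ) (b ϑ : T3 → ℝ) (w : T3 → V3), σ ≤ 1 / 2 → Continuous b → Continuous ϑ → Continuous w → (∀ x, 0 < b x) → (∀ x, 0 < ϑ x) → (∀ x, ϑ x ≤ Θm) → (∀ x, ‖w x‖ ≤ U) → ∀ (N : ℕ) (Φ : HardSphereFlow (Torus.geometry (Fin 3)) (hsDiameter σ N) (N + 1)) (K δ : ℝ), 0 ≤ δ → localGibbsLaw σ b w ϑ N Φ {z | 2 * A * Real.exp (-(K / (2 * Θ))) + δ < frac K z} ≤ ENNReal.ofReal (Real.exp (-(2 * ((N : ℝ) + 1) * δ ^ 2))) := by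
  intro Θm U hΘm
  obtain ⟨Θ, A, hΘ, hA, htail⟩ := exists_gauss_tail_bound hΘm U
  refine ⟨Θ, A, hΘ, hA, fun σ b ϑ w hσ2 hb hϑ hw hb0 hϑ0 hϑm hwU N Φ K δ hδ => ?_⟩
  set q : ℝ := A * Real.exp (-(K / (2 * Θ))) with hq
  have hq0 : 0 ≤ q := mul_nonneg hA (Real.exp_pos _).le
  -- the velocity event and its indicator
  set T : Set (Fin (N + 1) → V3) := {v | 2 * q + δ < ((N + 1 : ℕ) : ℝ)⁻¹ * ∑ i, (if K ≤ ‖v i‖ ^ 2 then (1 : ℝ) else 0)}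
    with hT
  have hS : MeasurableSet {v : V3 | K ≤ ‖v‖ ^ 2} := measurableSet_le measurable_const (measurable_norm.pow_const 2)
  have hFm : Measurable fun v : Fin (N + 1) → V3 => ((N + 1 : ℕ) : ℝ)⁻¹ * ∑ i, (if K ≤ ‖v i‖ ^ 2 then (1 : ℝ) else 0) :=
    measurable_const.mul (Finset.measurable_sum _ fun i _ =>
      (Measurable.ite hS measurable_const measurable_const).comp (measurable_pi_apply i))
  have hTm : MeasurableSet T := measurableSet_lt measurable_const hFm
  -- conditional bound, uniformly in the positions
  have hcond : ∀ x : Fin (N + 1) → T3, ∫⁻ v, T.indicator 1 v ∂velMeasure w ϑ x ≤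
      ENNReal.ofReal (Real.exp (-(2 * ((N : ℝ) + 1) * δ ^ 2))) := by
    intro x
    rw [lintegral_indicator_one hTm, velMeasure]
    exact pi_frac_gt_le (fun i => gaussMeasure (w (x i)) (ϑ (x i)))
      (fun i => htail (w (x i)) (ϑ (x i)) (hϑ0 _) (hϑm _) (hwU _) K) hq0 hδ
  -- disintegration
  have h := lintegral_vel_localGibbsLaw_le hb hϑ hw hb0 hϑ0 (g := T.indicator 1) (measurable_one.indicator hTm) hcond hσ2 Φ
  -- the configuration event is the preimage of `T` under the velocity map
  have hev : {z : Cfg N | 2 * A * Real.exp (-(K / (2 * Θ))) + δ < frac K z} =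
      (fun z : Cfg N => fun i => (z i).2) ⁻¹' T := by
    ext z
    simp only [mem_setOf_eq, mem_preimage, hT, frac_eq_avg, hq, mul_assoc]
  have hvelm : Measurable fun z : Cfg N => fun i => (z i).2 :=
    measurable_pi_lambda _ fun i => (measurable_pi_apply i).snd
  rw [hev, ← lintegral_indicator_one (hTm.preimage hvelm)]
  have hind : (fun z : Cfg N => ((fun z : Cfg N => fun i => (z i).2) ⁻¹' T).indicator (1 : Cfg N → ℝ≥0∞) z) =
      fun z => T.indicator 1 (fun i => (z i).2) := by
    funext z
    by_cases hz : (fun i => (z i).2) ∈ T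
    · rw [indicator_of_mem (show z ∈ (fun z : Cfg N => fun i => (z i).2) ⁻¹' T from hz), indicator_of_mem hz]
      rfl
    · rw [indicator_of_notMem (show z ∉ (fun z : Cfg N => fun i => (z i).2) ⁻¹' T from hz), indicator_of_notMem hz]
  rw [hind]
  exact h

end Summit.AtomisticToContinuum.HydrodynamicLimit.Theorems.FibreDeficitTransfer

end
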